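import Literature.AnabelianGeometry.SemiGraphs.TieBijective
import Literature.AnabelianGeometry.SemiGraphs.TieBranchClause
import HarnessLib

/-!
# The TIE without branch alignment: bijective section labels once every edge-cell is detected
# ([SemiAnbd] Def. 2.2 (i) p. 23, Rem. 2.2.1 p. 24, proof of Cor. 2.7 (i) p. 30)

Mochizuki, *Semi-graphs of anabelioids*, Publ. RIMS **42** (2006) 221–322, §2: Def. 2.2 (i) p. 23 (the
finite étale covering `ℋ → 𝒦` attached to `A ∈ B(𝒦)`: "the vertices (respectively, edges) of `𝔾′` that
lie over a vertex `v` (respectively, an edge `e`) correspond to the connected components of `S_v`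
(respectively, `T_e`)"), Rem. 2.2.1 p. 24, proof of Cor. 2.7 (i) p. 30
[cite: MochizukiSemiAnbd2006, Def. 2.2(i) p.23].

PROOF-ONLY (abc-iut cell, layer L3; FACT-LIST row F-1487 `covering_subgraphComponents_doubleCosets`
AS TYPED, CLASS route «regluing invisibility / mass balance» of abc-iut-w4-d080
(`HOME/staging/w4/w4-d080-g7/F1487-MASSBALANCE-MEMO.md` §2–§3, brick R6b «mass balance ⇒ label
injectivity»); seat abc-iut-L3-d2 (gen 10), row «F1487-R6-MASS-BALANCE»).

abc-iut-f-161's TIE (`tie_bijective`, `tie_localLabels`) proves that the canonical SECTION LABELS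
`O(w) ⊆ A_{ψ w}`, `O(e′) ⊆ A_{ψ e′}` of a covering `ψ : ℋ → 𝒦` (the components holding the global base
points) are bijections onto `Σ_u π₀(A_u)`, `Σ_e π₀(A_e)` — for coverings that are local ∧ global ∧
vertex-aligned ∧ BRANCH-ALIGNED; branch alignment enters only through «injectivity on stars».  This
file removes branch alignment in favour of a DETECTION hypothesis:

* `sigma_injective_of_surjective` — counting: a map over `𝕂` between sets with FINITE fibres of the
  same cardinalities is injective as soon as it is surjective (mass balance on each fibre);
* `tie_bijective_of_sectionE_surjective` — **THE TIE from detection**: if `ψ` is locally the covering of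
  `A`, globally so through `(αψ, e_ψ)`, vertex-aligned, and EVERY edge-cell `(e, Q)` of `𝔾_A` is the
  section label of some edge of `ℋ` over `e`, then `(O, O_E)` are BIJECTIONS, characterised by the
  factorisation of the tautological section and compatible with abutment (conclusion of `tie_bijective`
  verbatim): surjective edge labels are injective by counting, two branches at `w` over one branch of
  `𝕂` with equally labelled edges then have the same edge and coincide (`branchMap_injOn`), and
  abc-iut-f-161's labelled-lift assembly `FibreData.labels_bijective` finishes exactly as in
  `tie_bijective` (star count through `cV w ≅ O w`, connectedness of `𝔾_A` by (D8));
* `tie_localLabels_of_sectionE_surjective` — the same with clause (5) in the branch-clause shape of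
  `Hom.IsFiniteEtaleCoveringOf` (the output type of `tie_localLabels`, consumed by the sheet walk
  `Hom.sectionFibres_saturate`).

The detection hypothesis is supplied, cell by cell, by the regluing-invisibility engine: non-separating
cells (`Hom.exists_sectionE_label_of_reachable`, p511252) and cells with a non-separating port
(`Hom.exists_sectionE_label_of_port`, p512619).  No `def`, no new `Prop`; typed ≠ proved for F-1487 AS
TYPED; nothing here takes a side on [IUTchIII] Cor. 3.12.
-/

namespace Literature.AnabelianGeometry.SemiGraphs

namespace SemiGraphOfAnabelioids

namespace Hom

open CategoryTheory CategoryTheory.Limits CategoryTheory.PreGaloisCategory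
open Literature.AnabelianGeometry.Anabelioids

universe v₁ u₁ u

/-! ### Counting on finite fibres -/

/-- **Mass balance on a fibre.**  A map `a ↦ (p a, ℓ a)` into `Σ i, F i` whose fibres `p⁻¹(i)` are in
bijection with the FINITE sets `F i` is injective as soon as it is surjective: on each fibre it is a
surjection between finite sets of the same cardinality. [folklore] -/
private theorem sigma_injective_of_surjective {ι : Type*} {α : Type*} (p : α → ι) (F : ι → Type*)
    [∀ i, Finite (F i)] (ℓ : ∀ a, F (p a)) (eqv : ∀ i, Nonempty ({a // p a = i} ≃ F i))
    (hs : Function.Surjective fun a => (⟨p a, ℓ a⟩ : Σ i, F i)) :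
    Function.Injective fun a => (⟨p a, ℓ a⟩ : Σ i, F i) := by
  intro a a' h
  have hp : p a = p a' := congrArg Sigma.fst h
  have hℓ : HEq (ℓ a) (ℓ a') := (Sigma.mk.inj_iff.mp h).2
  -- the map on the fibre over `p a′`
  let g : {x // p x = p a'} → F (p a') := fun x => cast (congrArg F x.2) (ℓ x.1)
  have hg : Function.Surjective g := by
    intro y
    obtain ⟨x, hx⟩ := hs ⟨p a', y⟩
    have hx1 : p x = p a' := congrArg Sigma.fst hx
    have hx2 : HEq (ℓ x) y := (Sigma.mk.inj_iff.mp hx).2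
    exact ⟨⟨x, hx1⟩, cast_eq_iff_heq.mpr hx2⟩
  haveI : Finite {x // p x = p a'} := Finite.of_equiv _ (eqv (p a')).some.symm
  have hginj : Function.Injective g :=
    (Finite.injective_iff_surjective_of_equiv (eqv (p a')).some).mpr hg
  have key : g ⟨a, hp⟩ = g ⟨a', rfl⟩ := by
    change cast (congrArg F hp) (ℓ a) = cast _ (ℓ a')
    rw [cast_eq_iff_heq]
    exact hℓ.trans (cast_heq _ _).symm
  exact congrArg Subtype.val (hginj key)

/-! ### The TIE from detection -/

variable {ℋ 𝒦 : SemiGraphOfAnabelioids.{v₁, u₁, u}} (ψ : Hom ℋ 𝒦) (A : 𝒦.BObj)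
  [HasBinaryProducts 𝒦.BObj] (αψ : Over A ⥤ ℋ.BObj) [αψ.IsEquivalence]
  (eψ : ψ.pullbackFunctor ≅ Over.star A ⋙ αψ)

set_option backward.isDefEq.respectTransparency false in
/-- **THE TIE FROM DETECTION** ([SemiAnbd] Def. 2.2 (i): the vertices and edges of the covering ARE
the connected components of the `A_u`, `A_e` — here WITHOUT branch alignment).  Let `ψ : ℋ → 𝒦` be a
morphism of CONNECTED semi-graphs of anabelioids which is LOCALLY the covering attached to
`A ∈ B(𝒦)` (`IsFiniteEtaleCoveringOf`), GLOBALLY so through the witness `αψ : B(𝒦)_{/A} ⥲ B(ℋ)`,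
`e_ψ : ψ^* ≅ (A × −) ⋙ αψ`, and VERTEX-ALIGNED; assume that EVERY edge-cell `(e, Q)` of `𝔾_A` is
DETECTED: some edge `e′` of `ℋ` over `e` has the constituent `g_{e′}` of the tautological section
`g = αψ(η_{𝟙_A}) ≫ e_ψ⁻¹_A` factoring through `ψ_{e′}^*(Q ↪ A_e)`.  Then the section labels
`O(w) ∈ π₀(A_{ψ w})`, `O(e′) ∈ π₀(A_{ψ e′})` satisfy: (1) `w ↦ (ψ w, O w)` is a bijection onto
`Σ_u π₀(A_u)`; (2) `e′ ↦ (ψ e′, O e′)` is a bijection onto `Σ_e π₀(A_e)`; (3)/(4) `O(w)` (resp. `O(e′)`)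
is THE component through which `g_w` (resp. `g_{e′}`) factors; (5) for a branch `b′` at `w`, the
component of `A_{ψ w}` under `O(e(b′))` along `ψ b′` is `O(w)`.  (Surjectivity of the edge labels is
the hypothesis; injectivity by mass balance on the finite fibres; then abc-iut-f-161's labelled lift.)
[cite: MochizukiSemiAnbd2006, Def. 2.2(i) p.23] -/
theorem tie_bijective_of_sectionE_surjective (hloc : ψ.IsFiniteEtaleCoveringOf A)
    (hva : ψ.IsVertexAligned) (hℋ : ℋ.IsConnected) (h𝒦 : 𝒦.IsConnected)
    (hdet : ∀ (e : 𝒦.graph.Edge) (Q : π₀Obj (A.T e)),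
      ∃ (e' : ℋ.graph.Edge) (Q' : π₀Obj (A.T (ψ.base.edgeMap e'))),
        (⟨ψ.base.edgeMap e', Q'⟩ : Σ e, π₀Obj (A.T e)) = ⟨e, Q⟩ ∧
        ∃ k : (αψ.obj (Over.mk (𝟙 A))).T e' ⟶
            (ψ.φE e' (ψ.base.edgeMap e') rfl).pullback.obj (Q'.1 : 𝒦.E (ψ.base.edgeMap e')),
          k ≫ (ψ.φE e' (ψ.base.edgeMap e') rfl).pullback.map Q'.1.arrow =
            (αψ.map ((Over.forgetAdjStar A).unit.app (Over.mk (𝟙 A))) ≫ eψ.inv.app A).fT e') :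
    ∃ (O : ∀ w : ℋ.graph.Vertex, π₀Obj (A.S (ψ.base.vertexMap w)))
      (OE : ∀ e' : ℋ.graph.Edge, π₀Obj (A.T (ψ.base.edgeMap e'))),
      Function.Bijective (fun w : ℋ.graph.Vertex =>
        (⟨ψ.base.vertexMap w, O w⟩ : Σ u, π₀Obj (A.S u))) ∧
      Function.Bijective (fun e' : ℋ.graph.Edge =>
        (⟨ψ.base.edgeMap e', OE e'⟩ : Σ e, π₀Obj (A.T e))) ∧
      (∀ (w : ℋ.graph.Vertex) (P : π₀Obj (A.S (ψ.base.vertexMap w))),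
        P = O w ↔ ∃ k : (αψ.obj (Over.mk (𝟙 A))).S w ⟶
            (ψ.φV w).pullback.obj (P.1 : 𝒦.V (ψ.base.vertexMap w)),
          k ≫ (ψ.φV w).pullback.map P.1.arrow =
            (αψ.map ((Over.forgetAdjStar A).unit.app (Over.mk (𝟙 A))) ≫ eψ.inv.app A).fS w) ∧
      (∀ (e' : ℋ.graph.Edge) (Q : π₀Obj (A.T (ψ.base.edgeMap e'))),
        Q = OE e' ↔ ∃ k : (αψ.obj (Over.mk (𝟙 A))).T e' ⟶
            (ψ.φE e' (ψ.base.edgeMap e') rfl).pullback.obj (Q.1 : 𝒦.E (ψ.base.edgeMap e')),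
          k ≫ (ψ.φE e' (ψ.base.edgeMap e') rfl).pullback.map Q.1.arrow =
            (αψ.map ((Over.forgetAdjStar A).unit.app (Over.mk (𝟙 A))) ≫ eψ.inv.app A).fT e') ∧
      (∀ (b' : ℋ.graph.Branch) (w : ℋ.graph.Vertex) (h' : ℋ.graph.abuts b' = some w),
        A.componentOver (ψ.base.branchMap b') (ψ.base.vertexMap w) (ψ.base.abuts_branchMap b' w h')
            ((ψ.base.edgeOf_branchMap b').symm ▸ OE (ℋ.graph.edgeOf b')) = O w) := by
  classical
  -- the labels
  have hU := fun w => existsUnique_component_section_factors ψ A αψ eψ w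
  have hUE := fun e' => existsUnique_component_sectionE_factors ψ A αψ eψ e'
  choose O hO using fun w => (hU w).exists
  choose OE hOE using fun e' => (hUE e').exists
  -- (5) abutment compatibility (global clause only)
  have h5 : ∀ (b' : ℋ.graph.Branch) (w : ℋ.graph.Vertex) (h' : ℋ.graph.abuts b' = some w),
      A.componentOver (ψ.base.branchMap b') (ψ.base.vertexMap w) (ψ.base.abuts_branchMap b' w h')
        ((ψ.base.edgeOf_branchMap b').symm ▸ OE (ℋ.graph.edgeOf b')) = O w := fun b' w h' =>
    componentOver_eq_of_section_factors ψ A αψ eψ w b' h' (ψ.base.branchMap b') rfl (O w) (hO w) _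
      (sectionE_factors_reindex ψ A αψ eψ _ _ (ψ.edgeMap_edgeOf_of_branchMap b' _ rfl) (OE _) (hOE _))
  -- (2), surjectivity: every edge-cell is detected, and the detected label is THE label
  have hsurjE : Function.Surjective (fun e' : ℋ.graph.Edge =>
      (⟨ψ.base.edgeMap e', OE e'⟩ : Σ e, π₀Obj (A.T e))) := by
    rintro ⟨e, Q⟩
    obtain ⟨e', Q', hQ', hk⟩ := hdet e Q
    refine ⟨e', ?_⟩
    have hQ'E : Q' = OE e' := (hUE e').unique hk (hOE e')
    change (⟨ψ.base.edgeMap e', OE e'⟩ : Σ e, π₀Obj (A.T e)) = ⟨e, Q⟩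
    rw [← hQ'E]
    exact hQ'
  -- the local description
  obtain ⟨hprop, cV, cE, hbijV, hbijE, hαV, -, hbr⟩ := _root_.id hloc
  -- the fibre data `𝔾_A` and the shrunk labels
  let D := A.fibreData
  let ℓV : ∀ w : ℋ.graph.Vertex, D.FV (ψ.base.vertexMap w) := fun w => equivShrink _ (O w)
  let ℓE : ∀ e' : ℋ.graph.Edge, D.FE (ψ.base.edgeMap e') := fun e' => equivShrink _ (OE e')
  haveI : ∀ u, Finite (D.FV u) := fun u => Finite.of_equiv _ (equivShrink (π₀Obj (A.S u)))
  haveI : ∀ e, Finite (D.FE e) := fun e => Finite.of_equiv _ (equivShrink (π₀Obj (A.T e)))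
  -- the fibres of `ψ` have the cardinalities of `𝔾_A` (local labels)
  have eV : ∀ u, Nonempty (ψ.base.VertexFiber u ≃ D.FV u) := fun u =>
    D.nonempty_vertexFiber_equiv_of_bijective ψ.base (fun w => equivShrink _ (cV w))
      ((Equiv.sigmaCongrRight fun v => equivShrink (π₀Obj (A.S v))).bijective.comp hbijV) u
  have eE : ∀ e, Nonempty (ψ.base.EdgeFiber e ≃ D.FE e) := fun e =>
    D.nonempty_edgeFiber_equiv_of_bijective ψ.base (fun e' => equivShrink _ (cE e'))
      ((Equiv.sigmaCongrRight fun e => equivShrink (π₀Obj (A.T e))).bijective.comp hbijE) e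
  -- (2), injectivity: mass balance on the finite fibres over the edges of `𝕂`
  have hinjE : Function.Injective (fun e' : ℋ.graph.Edge =>
      (⟨ψ.base.edgeMap e', OE e'⟩ : Σ e, π₀Obj (A.T e))) :=
    sigma_injective_of_surjective ψ.base.edgeMap (fun e => π₀Obj (A.T e)) OE
      (fun e => ⟨(eE e).some.trans (equivShrink (π₀Obj (A.T e))).symm⟩) hsurjE
  have hcast : ∀ {e₁ e₂ : 𝒦.graph.Edge} (h : e₁ = e₂) (Q : π₀Obj (A.T e₁)),
      cast (congrArg D.FE h) (equivShrink _ Q) = equivShrink _ (h ▸ Q : π₀Obj (A.T e₂)) := by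
    intro e₁ e₂ h Q
    subst h
    rfl
  -- compatibility with abutment
  have hcompat : ∀ (b' : ℋ.graph.Branch) (w : ℋ.graph.Vertex) (h' : ℋ.graph.abuts b' = some w),
      D.σ (ψ.base.branchMap b') (ψ.base.vertexMap w) (ψ.base.abuts_branchMap b' w h')
        (cast (congrArg D.FE (ψ.base.edgeOf_branchMap b').symm) (ℓE (ℋ.graph.edgeOf b'))) = ℓV w := by
    intro b' w h'
    change equivShrink _ (A.componentOver _ _ _
      ((equivShrink _).symm (cast _ (equivShrink _ (OE (ℋ.graph.edgeOf b')))))) = equivShrink _ (O w)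
    rw [hcast (ψ.base.edgeOf_branchMap b').symm, Equiv.symm_apply_apply, h5 b' w h']
  -- injectivity on stars: equally labelled edges over one branch are equal, hence so are the branches
  have hinj : ∀ (w : ℋ.graph.Vertex) (b'₁ b'₂ : ℋ.graph.Branch), ℋ.graph.abuts b'₁ = some w →
      ℋ.graph.abuts b'₂ = some w → ψ.base.branchMap b'₁ = ψ.base.branchMap b'₂ →
      (⟨ψ.base.edgeMap (ℋ.graph.edgeOf b'₁), ℓE (ℋ.graph.edgeOf b'₁)⟩ : Σ e, D.FE e) =
        ⟨ψ.base.edgeMap (ℋ.graph.edgeOf b'₂), ℓE (ℋ.graph.edgeOf b'₂)⟩ → b'₁ = b'₂ :=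
    fun w b'₁ b'₂ _ _ hb hs =>
      ψ.base.branchMap_injOn b'₁ b'₂ (hinjE (sigma_eq_of_sigma_shrink_eq A _ _ hs)) hb
  -- the star count: through `cV w ≅ O w` and the local clause
  have hcard : ∀ (w : ℋ.graph.Vertex) (b : 𝒦.graph.Branch)
      (hb : 𝒦.graph.abuts b = some (ψ.base.vertexMap w)),
      Nat.card {c : D.FE (𝒦.graph.edgeOf b) // D.σ b (ψ.base.vertexMap w) hb c = ℓV w} ≤
        Nat.card {b' : ℋ.graph.Branch // ℋ.graph.abuts b' = some w ∧ ψ.base.branchMap b' = b} := by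
    intro w b hb
    obtain ⟨αw, hαw, ⟨ew⟩⟩ := hαV w
    haveI := hαw
    haveI := (cV w).2
    obtain ⟨i, -⟩ := nonempty_iso_of_localGlobalSection ψ A αψ eψ hva w
      ((cV w).1 : 𝒦.V (ψ.base.vertexMap w)) (cV w).1.arrow αw ew (O w) (hO w)
    have e1 : {c : D.FE (𝒦.graph.edgeOf b) // D.σ b (ψ.base.vertexMap w) hb c = ℓV w} ≃
        {Q : π₀Obj (A.T (𝒦.graph.edgeOf b)) // A.componentOver b (ψ.base.vertexMap w) hb Q = O w} :=
      Equiv.subtypeEquiv (equivShrink _).symm (fun c =>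
        (equivShrink (π₀Obj (A.S (ψ.base.vertexMap w)))).apply_eq_iff_eq)
    calc Nat.card {c : D.FE (𝒦.graph.edgeOf b) // D.σ b (ψ.base.vertexMap w) hb c = ℓV w}
        = Nat.card {Q : π₀Obj (A.T (𝒦.graph.edgeOf b)) //
            A.componentOver b (ψ.base.vertexMap w) hb Q = O w} := Nat.card_congr e1
      _ = Nat.card {Q : π₀Obj (A.T (𝒦.graph.edgeOf b)) //
            Q.1 ≤ A.branchImage b (ψ.base.vertexMap w) hb (O w).1} :=
          Nat.card_congr (Equiv.subtypeEquivRight fun Q =>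
            A.componentOver_eq_iff_le_branchImage b _ hb Q (O w))
      _ = Nat.card {Q : π₀Obj (A.T (𝒦.graph.edgeOf b)) //
            Q.1 ≤ A.branchImage b (ψ.base.vertexMap w) hb (cV w).1} :=
          (A.natCard_le_branchImage_eq_of_iso b _ hb (cV w) (O w) i).symm
      _ = Nat.card {Q : π₀Obj (A.T (𝒦.graph.edgeOf b)) //
            A.componentOver b (ψ.base.vertexMap w) hb Q = cV w} :=
          Nat.card_congr (Equiv.subtypeEquivRight fun Q =>
            (A.componentOver_eq_iff_le_branchImage b _ hb Q (cV w)).symm)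
      _ ≤ _ := natCard_componentOver_eq_le_natCard_branches ψ A cV cE hprop hbijV.1 hbijE hbr w b hb
  -- `𝔾_A` is connected: `A` is connected since `ℋ` is ((D8))
  haveI : PreGaloisCategory.IsConnected A :=
    isConnected_of_isGlobalCovering hℋ ψ A ⟨‹_›, αψ, ‹_›, ⟨eψ⟩⟩
  have hconn : D.total.IsConnected :=
    (covering_isConnected_holds 𝒦 A.coveringGraph A.coveringHomCan A h𝒦
      A.coveringHomCan_isFiniteEtaleCoveringOf ‹_›).isConnected
  -- abc-iut-f-161's labelled lift
  obtain ⟨hbV, hbE⟩ := D.labels_bijective ψ.base ℓV ℓE hprop hcompat hinj hcard hconn eV eE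
  refine ⟨O, OE, ?_, ?_, fun w P => ⟨fun h => h ▸ hO w, fun hP => (hU w).unique hP (hO w)⟩,
    fun e' Q => ⟨fun h => h ▸ hOE e', fun hQ => (hUE e').unique hQ (hOE e')⟩, h5⟩
  · have hf : (fun w : ℋ.graph.Vertex => (⟨ψ.base.vertexMap w, O w⟩ : Σ u, π₀Obj (A.S u))) =
        (Equiv.sigmaCongrRight fun u => (equivShrink (π₀Obj (A.S u))).symm) ∘
          (fun w : ℋ.graph.Vertex => (⟨ψ.base.vertexMap w, ℓV w⟩ : Σ u, D.FV u)) := by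
      funext w
      change _ = (⟨ψ.base.vertexMap w, (equivShrink _).symm (equivShrink _ (O w))⟩ :
        Σ u, π₀Obj (A.S u))
      rw [Equiv.symm_apply_apply]
    rw [hf]
    exact (Equiv.bijective _).comp hbV
  · exact ⟨hinjE, hsurjE⟩

/-- **THE TIE FROM DETECTION, branch-clause form** (the output type of abc-iut-f-161's
`tie_localLabels`, consumed by abc-iut-L3-d3's sheet walk `Hom.sectionFibres_saturate`): under the
hypotheses of `tie_bijective_of_sectionE_surjective` — local ∧ global ∧ vertex-aligned, every edge-cell
of `𝔾_A` detected, NO branch alignment — there are labels `O`, `O_E` with (1)/(2) `w ↦ (ψ w, O w)`,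
`e′ ↦ (ψ e′, O e′)` bijective, (3)/(4) characterised by the factorisation of the tautological section,
and (5) the branch clause of `Hom.IsFiniteEtaleCoveringOf` for `(O, O_E)`.
[cite: MochizukiSemiAnbd2006, Def. 2.2(i) p.23] -/
theorem tie_localLabels_of_sectionE_surjective (hloc : ψ.IsFiniteEtaleCoveringOf A)
    (hva : ψ.IsVertexAligned) (hℋ : ℋ.IsConnected) (h𝒦 : 𝒦.IsConnected)
    (hdet : ∀ (e : 𝒦.graph.Edge) (Q : π₀Obj (A.T e)),
      ∃ (e' : ℋ.graph.Edge) (Q' : π₀Obj (A.T (ψ.base.edgeMap e'))),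
        (⟨ψ.base.edgeMap e', Q'⟩ : Σ e, π₀Obj (A.T e)) = ⟨e, Q⟩ ∧
        ∃ k : (αψ.obj (Over.mk (𝟙 A))).T e' ⟶
            (ψ.φE e' (ψ.base.edgeMap e') rfl).pullback.obj (Q'.1 : 𝒦.E (ψ.base.edgeMap e')),
          k ≫ (ψ.φE e' (ψ.base.edgeMap e') rfl).pullback.map Q'.1.arrow =
            (αψ.map ((Over.forgetAdjStar A).unit.app (Over.mk (𝟙 A))) ≫ eψ.inv.app A).fT e') :
    ∃ (O : ∀ w : ℋ.graph.Vertex, π₀Obj (A.S (ψ.base.vertexMap w)))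
      (OE : ∀ e' : ℋ.graph.Edge, π₀Obj (A.T (ψ.base.edgeMap e'))),
      Function.Bijective (fun w : ℋ.graph.Vertex =>
        (⟨ψ.base.vertexMap w, O w⟩ : Σ u, π₀Obj (A.S u))) ∧
      Function.Bijective (fun e' : ℋ.graph.Edge =>
        (⟨ψ.base.edgeMap e', OE e'⟩ : Σ e, π₀Obj (A.T e))) ∧
      (∀ (w : ℋ.graph.Vertex) (P : π₀Obj (A.S (ψ.base.vertexMap w))),
        P = O w ↔ ∃ k : (αψ.obj (Over.mk (𝟙 A))).S w ⟶
            (ψ.φV w).pullback.obj (P.1 : 𝒦.V (ψ.base.vertexMap w)),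
          k ≫ (ψ.φV w).pullback.map P.1.arrow =
            (αψ.map ((Over.forgetAdjStar A).unit.app (Over.mk (𝟙 A))) ≫ eψ.inv.app A).fS w) ∧
      (∀ (e' : ℋ.graph.Edge) (Q : π₀Obj (A.T (ψ.base.edgeMap e'))),
        Q = OE e' ↔ ∃ k : (αψ.obj (Over.mk (𝟙 A))).T e' ⟶
            (ψ.φE e' (ψ.base.edgeMap e') rfl).pullback.obj (Q.1 : 𝒦.E (ψ.base.edgeMap e')),
          k ≫ (ψ.φE e' (ψ.base.edgeMap e') rfl).pullback.map Q.1.arrow =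
            (αψ.map ((Over.forgetAdjStar A).unit.app (Over.mk (𝟙 A))) ≫ eψ.inv.app A).fT e') ∧
      (∀ (b' : ℋ.graph.Branch) (v' : ℋ.graph.Vertex) (h' : ℋ.graph.abuts b' = some v'),
        ∃ f : ((OE (ℋ.graph.edgeOf b')).1 : 𝒦.E (ψ.base.edgeMap (ℋ.graph.edgeOf b'))) ⟶
            (𝒦.transportE (ψ.base.edgeOf_branchMap b')).obj
              ((𝒦.pull (ψ.base.branchMap b') (ψ.base.vertexMap v')
                (ψ.base.abuts_branchMap b' v' h')).pullback.obj ((O v').1 : 𝒦.V (ψ.base.vertexMap v'))),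
          f ≫ (𝒦.transportE (ψ.base.edgeOf_branchMap b')).map
                ((𝒦.pull _ _ (ψ.base.abuts_branchMap b' v' h')).pullback.map (O v').1.arrow ≫
                  (A.ψ (ψ.base.branchMap b') (ψ.base.vertexMap v') (ψ.base.abuts_branchMap b' v' h')).hom) ≫
              eqToHom (𝒦.transportE_obj_T A (ψ.base.edgeOf_branchMap b')) =
            (OE (ℋ.graph.edgeOf b')).1.arrow) := by
  obtain ⟨O, OE, h1, h2, h3, h4, h5⟩ :=
    tie_bijective_of_sectionE_surjective ψ A αψ eψ hloc hva hℋ h𝒦 hdet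
  exact ⟨O, OE, h1, h2, h3, h4, branchClause_of_componentOver_eq ψ A O OE h5⟩

omit [αψ.IsEquivalence] in
/-- **Re-indexing a detected label to the canonical presentation.**  A factorisation of
`g_{e′} ≫ reindex` through `ψ_{e′}^*(Q ↪ A_e)` at ANY name `e` of the edge `ψ e′` (`p : ψ e′ = e`; the
shape produced by the detection theorems `exists_sectionE_label_of_reachable` / `_of_port`) is a
factorisation of `g_{e′}` through the transported component at the name `ψ e′` (the shape of the
hypothesis `hdet` above). [cite: MochizukiSemiAnbd2006, Rem. 2.4.2 p.26] -/
theorem sectionE_detected_of_reindex (e' : ℋ.graph.Edge) (e : 𝒦.graph.Edge) (p : ψ.base.edgeMap e' = e)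
    (Q : π₀Obj (A.T e))
    (hQ : ∃ t : (αψ.obj (Over.mk (𝟙 A))).T e' ⟶ (ψ.φE e' e p).pullback.obj (Q.1 : 𝒦.E e),
      t ≫ (ψ.φE e' e p).pullback.map Q.1.arrow ≫ (ψ.reindexIso e' e (ψ.base.edgeMap e') p rfl).hom.app A =
        (αψ.map ((Over.forgetAdjStar A).unit.app (Over.mk (𝟙 A))) ≫ eψ.inv.app A).fT e') :
    ∃ (Q' : π₀Obj (A.T (ψ.base.edgeMap e'))),
      (⟨ψ.base.edgeMap e', Q'⟩ : Σ e, π₀Obj (A.T e)) = ⟨e, Q⟩ ∧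
      ∃ k : (αψ.obj (Over.mk (𝟙 A))).T e' ⟶
          (ψ.φE e' (ψ.base.edgeMap e') rfl).pullback.obj (Q'.1 : 𝒦.E (ψ.base.edgeMap e')),
        k ≫ (ψ.φE e' (ψ.base.edgeMap e') rfl).pullback.map Q'.1.arrow =
          (αψ.map ((Over.forgetAdjStar A).unit.app (Over.mk (𝟙 A))) ≫ eψ.inv.app A).fT e' := by
  subst p
  obtain ⟨t, ht⟩ := hQ
  refine ⟨Q, rfl, t, ?_⟩
  rw [Hom.reindexIso, eqToIso_refl, Iso.refl_hom, NatTrans.id_app] at ht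
  erw [Category.comp_id] at ht
  exact ht

end Hom

end SemiGraphOfAnabelioids

end Literature.AnabelianGeometry.SemiGraphs
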